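import Summits.QuantumFields.QCD.Theorems.NestedDissectionSeaLightQuarkCompletionGlue
import Summits.QuantumFields.QCD.Theorems.NestedDissectionSeaLightQuarkCompletionStubJumpGerm
import Summits.QuantumFields.QCD.Theorems.NestedDissectionSeaLightQuarkCompletionPhysicalBranchOfFrame
import Summits.QuantumFields.QCD.Theorems.NestedDissectionSeaLightQuarkCompletionOfChiralCornerPinned
import Summits.QuantumFields.QCD.Theorems.NestedDissectionSeaLightQuarkCompletionBandPinsOfCorner
import Summits.QuantumFields.QCD.Theorems.NestedDissectionSeaLightQuarkCompletionStubChiralCompletionOfMassContinuation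
import Summits.QuantumFields.QCD.Theorems.LightQuarkCompletion.Negative.Anatomy

/-!
# Crux `LightQuarkCompletion` (stmt-QuantumFields-18066, route NestedDissectionSea, rank 6) — line `Sketch`:
# the registered skeleton, rev 6 (lead prover-line-stmt-QuantumFields-18066-c4-0, 2026-08-17; rev 5 by lead c3)

`Summit.QuantumFields.QCD.Theses.NestedDissectionSea.LightQuarkCompletion`: for `N_f ∈ {2,3}`, every THRESHOLD
regularisation `reg` — `HasMassScaling`, two-loop `HasAsymptoticScaling`, weak branch (`-1 ≤ m_crit(k)` eventually),
a threshold `M₀ ≥ 0`, the two-sided parity pin above `M₀` (lower pin (b) = `CoerciveSeaNegative.PinClause`, upper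
pin (b″) = `EarlyCrosserLawNegative.UpperPin`, both VERBATIM the crux's clauses) and the `QCDOf` body at every mass
tuple `> M₀` — admits a regularisation `reg'` with both scalings, `m_crit' → 0`, the two-sided pin at ZERO threshold,
`IsChiralAtZero`, and the body at EVERY positive tuple.

## Rev 6 = rev 5 (lead c3: rev 3 with every landed reduction imported, the stubs in their sharpest by-name forms, and a
## SECOND composition through the sibling item `HeavyThresholdYMBridge.ChiralCompletion` (stmt-17661) — landed as
## `lightQuarkCompletion_of_chiralCornerPinned` (p142691) — whose 17661-stub is itself supplied BY NAME by
## `QuarksAsStableAction.MassContinuation ∧ ChiralTupleGapless` (items 18327, 18328; landed p142846)) with composition B's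
## ONE supplier-less stub RESHAPED from the ∀δ-form `stub_chiralCornerPinned` to the LOCATED form
## `stub_chiralCornerPinnedExists` — exactly the clause the composition consumes (lead c4)

### Composition A (§2, the planner's glued split B2 `ZeroThresholdDescent` → J `JumpLineIsChiral`; four stubs)

The witness is `reg` reindexed along a subsequence `φ`, RE-CENTRED at a jump germ `J`
(`m_crit'(k) = m_crit(φ k) + a_{φ k} J / Z_m(φ k)`), reindexed once more along `ψ` on which the light body is certified.

* `stub_bandPinsAlong` (B2a, rev-4 form of `stub_jumpGerm`, EQUIVALENT to it by the landed `jumpGerm_iff_bandPinsAlong`,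
  p141269): along SOME subsequence `φ` and at SOME germ `J`, for every positive tuple `m`, a common radius carries the lower pin
  of `reg.restrict φ` from depth `−J` and its upper pin from height `J`, weights at `J + m` — EarlyCrosserLaw (b),(b″) at zero
  threshold relative to the germ, read along the GIVEN regularisation (= the planner's `JumpBandSharp`).  OPEN, no supplier in
  the tree; the `J = M₀` shortcut is dead (Negative `BandLowerPin`, p140088).
* `stub_frame` (B2b′): conjunct (α) of the route crux `FrameAndSeparatorLaw` (item stmt-QuantumFields-17012) BY NAME; B2b is
  its corollary `physicalBranch_of_frame` (landed p139960, imported).  DELEGATED to item 17012.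
* `stub_lightBodySubseq` (B2c′, verbatim rev 3): the body of the re-centred regularisation at EVERY positive tuple along SOME
  further subsequence.  REDUCED (landed p140998, `stub_lightBodySubseq_of_retypedContinuumComplement` /
  `_of_massContinuation`) to item 16903 `EulerDescent.RetypedContinuumComplement` (or 18327 `QuarksAsStableAction.MassContinuation`)
  PLUS a light lattice gap above the germ for the given `reg` — the latter has no supplier.  OPEN.
* `stub_jumpLineIsChiral` (J, verbatim rev 1–3 = the planner's child `JumpLineIsChiral` in `∀ reg'` form).  OPEN, crux-sized
  (⇔ `¬ UniformlyGappedZeroPinnedQCD N_f`, Negative `stubJumpLineIsChiral_iff_not_exists`; the zero-threshold pin and the flavour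
  guard are load-bearing, Negative `LineSketchLoadBearing` / `FlavourRestriction`).  Held by the lead.

### Composition B (§3, new in rev 4, landed in rev 5, RESHAPED in rev 6; two further stubs, sharing `stub_frame`)

The crux's own informal text names the sibling `HeavyThresholdYMBridge.ChiralCompletion` (stmt-QuantumFields-17661) as "the
nearest statement: implies this node with the pin forgotten — re-pin by δ".  Made precise: from the threshold package,
17661 supplies an RGI offset `δ` such that the up-shifted regularisation `upShift reg δ` (`m_crit ↦ m_crit + a δ/Z_m`,
Negative `Anatomy`) is CHIRAL AT ZERO and carries the BODY AT EVERY POSITIVE TUPLE — a CORNER of the up-shift family of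
`reg`; both scalings survive the up-shift and `m_crit → 0` comes from (α) (`stub_frame`) and `a δ / Z_m → 0`.  What is then
missing from the crux's conclusion is exactly ONE clause: the two-sided pin at zero threshold at a corner.  Rev 4/5 asked for
it at EVERY corner (`stub_chiralCornerPinned`, ∀δ-form); but the corner set `{δ | chiral ∧ body}` is only known to be
order-connected (chirality descends, the body ascends under up-shifts — `ordConnected_cornerSet`, lead c4), physically the
single chiral offset yet formally possibly an interval, on which pins at two corners clash for compatible radii (Negative
`PinClash`).  Rev 6 registers the LOCATED form `stub_chiralCornerPinnedExists` ("if the corner set is inhabited, some corner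
carries the two-sided parity pin at zero threshold") — implied by the ∀δ-form (`chiralCornerPinnedExists_of_forall`) and
exactly what the composition uses.  Physics unchanged: the chiral corner of a threshold-pinned regularisation IS its
parity-jump line (EarlyCrosserLaw (b),(b″) at zero threshold read at the corner).  Stubs of §3: `stub_frame` (17012, by
name) | `stub_chiralCompletion17661` (item 17661 VERBATIM — its Theses decl is still not in the farm's olean of
`HeavyThresholdYMBridge`, probe 2026-08-17T05:45Z; swap for the name when served — AND supplied by name by items 18327 ∧ 18328
through the landed `stub_chiralCompletion17661_of_massContinuation`, p142846) | `stub_chiralCornerPinnedExists` (OPEN, no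
supplier).  The composition is `LightQuarkCompletion_of_chiralCompletion` below (its landable form
`lightQuarkCompletion_of_chiralCornerPinnedExists` is a registered helper, proposed by lead c4), and
`LightQuarkCompletion_of_stableActionItems` the instance with 17661 replaced by the two QuarksAsStableAction items.
Cross-link (landed p142790, for the ∀δ-form): composition B's facts imply composition A's `stub_bandPinsAlong`; for the located
form the same un-re-centring (`bandPinsAlong_id_of_pinPkg_upShift`) gives B2a from the pinned corner.

Either composition closes the crux: A modulo {17012, BandPinsAlong, 16903 + light gap above the germ, J}; B modulo
{17012, 17661 (or 18327 ∧ 18328), ChiralCornerPinnedExists}.  No definition is introduced (statement abbreviations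
`PinPkg`/`Body`/`HypAt`/`upShift` are the landed Negative `Anatomy` ones), so each stub can land under `Theorems/` with exactly
its registered signature.
-/

noncomputable section

namespace Summit.QuantumFields.QCD.Theorems.LightQuarkJumpLine

open MeasureTheory Filter Topology
open Literature.MathematicalPhysics.QuantumFieldTheory Literature.MathematicalPhysics.QuantumLattice
  Literature.Probability.LatticeModels
open Summit.QuantumFields.QCD.Theorems.CoerciveSeaNegative (PinClause tendsto_a_div_Zm massExponent_pos)
open Summit.QuantumFields.QCD.Theorems.EarlyCrosserLawNegative (UpperPin)
open Summit.QuantumFields.QCD.Theorems.FrameAndSeparatorLawNegative (Frame twoSidedPin_iff)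
open Summit.QuantumFields.QCD.Theorems.LightQuarkCompletion.Negative
  (PinPkg Body HypAt Concl upShift lightQuarkCompletion_iff upShift_scheme hasMassScaling_upShift
    hasAsymptoticScaling_upShift tendsto_mcrit_upShift)

/-! ## §1 The stubs of composition A -/

/-- **Stub B2a — band pins along a subsequence** (rev-4 form of `stub_jumpGerm`; equivalent to it by the landed
`jumpGerm_iff_bandPinsAlong`).  For every threshold regularisation `reg` of `N_f ∈ {2,3}` (both scalings, weak branch,
two-sided pin and body above `M₀ ≥ 0`) there are a subsequence `φ` and a germ `J : ℝ` such that for every positive tuple `m`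
a common radius `R > 0` carries the lower pin of `reg.restrict φ` from depth `−J` and its upper pin from height `J`, weights
at the sea tuple `J + m`: the jump band of RGI half-width `M₀` sharpens to `o(a_k/Z_m)` around germs `J_k ∈ [−M₀, M₀]`,
`J_{φ k} → J` (EarlyCrosserLaw (b),(b″) at zero threshold along the GIVEN regularisation = the planner's `JumpBandSharp`).
OPEN, no supplier in the tree. -/
theorem stub_bandPinsAlong : ∀ Nf : ℕ, (Nf = 2 ∨ Nf = 3) → ∀ reg : QCDRegularisation Nf, reg.HasMassScaling →
    (reg.scheme 0 0 0).HasAsymptoticScaling → (∀ᶠ k : ℕ in atTop, -1 ≤ reg.mcrit k) → ∀ M₀ : ℝ, 0 ≤ M₀ →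
    (∀ m : Fin Nf → ℝ, (∀ f, M₀ < m f) → ∃ R : ℝ, 0 < R ∧ PinClause Nf reg M₀ m R ∧ UpperPin Nf reg M₀ m R) →
    (∀ m : Fin Nf → ℝ, (∀ f, M₀ < m f) → ∃ (z shift : QCDField Nf → ℕ → ℝ) (T : OSData (QCDField Nf) 4),
      IsQCDAlong (reg.scheme m z shift) T ∧ T.IsNontrivial QCDField.glue ∧ T.IsNonGaussian QCDField.glue ∧
        (∀ f g : Fin Nf, f ≠ g → T.IsNontrivial (QCDField.pseudoRe f g)) ∧
          ∃ Δ > 0, T.HasMassGap Δ ∧ (reg.scheme m z shift).HasLatticeMassGap Δ) →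
    ∃ (φ : ℕ → ℕ) (hφ : StrictMono φ) (J : ℝ), ∀ m : Fin Nf → ℝ, (∀ f, 0 < m f) → ∃ R : ℝ, 0 < R ∧
      PinClause Nf (reg.restrict φ hφ.tendsto_atTop) (-J) (fun f => J + m f) R ∧
      UpperPin Nf (reg.restrict φ hφ.tendsto_atTop) J (fun f => J + m f) R := by
  sorry

/-- **Stub B2b′ — the frame (α) of the route crux `FrameAndSeparatorLaw` (item stmt-QuantumFields-17012), BY NAME.**
Along every admissible regularisation of `N_f ∈ {2,3}` (both scalings), a two-sided parity pin above some threshold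
`M₀ ≥ 0` forces `m_crit(k) → 0`.  B2b (`m_crit → 0` for the threshold `reg`) is its corollary `physicalBranch_of_frame`
(landed, p139960).  DELEGATED to item 17012 (OPEN there); shared by compositions A and B. -/
theorem stub_frame : Frame := by
  sorry

/-- **Stub B2c′ — the light body along a subsequence** (verbatim rev 3; the standing disprover's reshape, Disproof §11).
For a threshold regularisation as above, re-centred at a germ `J` carrying the two-sided pin at zero threshold, there is a
subsequence `ψ` along which the `QCDOf` body holds at EVERY positive tuple of the re-centred, reindexed regularisation.  Above
`M₀ − J` it is the hypothesis re-based (`lightBody_above`, p137103); below it is the light-quark continuation of the body (IR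
completion), REDUCED by the landed `stub_lightBodySubseq_of_retypedContinuumComplement` (p140998) to item 16903 plus a light
lattice gap above the germ.  OPEN. -/
theorem stub_lightBodySubseq : ∀ Nf : ℕ, (Nf = 2 ∨ Nf = 3) → ∀ reg : QCDRegularisation Nf, reg.HasMassScaling →
    (reg.scheme 0 0 0).HasAsymptoticScaling → (∀ᶠ k : ℕ in atTop, -1 ≤ reg.mcrit k) → ∀ M₀ : ℝ, 0 ≤ M₀ →
    (∀ m : Fin Nf → ℝ, (∀ f, M₀ < m f) → ∃ R : ℝ, 0 < R ∧ PinClause Nf reg M₀ m R ∧ UpperPin Nf reg M₀ m R) →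
    (∀ m : Fin Nf → ℝ, (∀ f, M₀ < m f) → ∃ (z shift : QCDField Nf → ℕ → ℝ) (T : OSData (QCDField Nf) 4),
      IsQCDAlong (reg.scheme m z shift) T ∧ T.IsNontrivial QCDField.glue ∧ T.IsNonGaussian QCDField.glue ∧
        (∀ f g : Fin Nf, f ≠ g → T.IsNontrivial (QCDField.pseudoRe f g)) ∧
          ∃ Δ > 0, T.HasMassGap Δ ∧ (reg.scheme m z shift).HasLatticeMassGap Δ) →
    ∀ J : ℝ, (∀ m : Fin Nf → ℝ, (∀ f, 0 < m f) → ∃ R : ℝ, 0 < R ∧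
      PinClause Nf (QCDRegularisation.mk reg.a reg.a_pos reg.tendsto_a reg.β reg.L reg.tendsto_L
        (fun k => reg.mcrit k + reg.a k * J / reg.Zm k) reg.Zm reg.Zm_pos) 0 m R ∧
      UpperPin Nf (QCDRegularisation.mk reg.a reg.a_pos reg.tendsto_a reg.β reg.L reg.tendsto_L
        (fun k => reg.mcrit k + reg.a k * J / reg.Zm k) reg.Zm reg.Zm_pos) 0 m R) →
    ∃ (ψ : ℕ → ℕ) (hψ : StrictMono ψ), ∀ m : Fin Nf → ℝ, (∀ f, 0 < m f) →
      ∃ (z shift : QCDField Nf → ℕ → ℝ) (T : OSData (QCDField Nf) 4),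
      IsQCDAlong (((QCDRegularisation.mk reg.a reg.a_pos reg.tendsto_a reg.β reg.L reg.tendsto_L
        (fun k => reg.mcrit k + reg.a k * J / reg.Zm k) reg.Zm reg.Zm_pos : QCDRegularisation Nf).restrict ψ
          hψ.tendsto_atTop).scheme m z shift) T ∧ T.IsNontrivial QCDField.glue ∧ T.IsNonGaussian QCDField.glue ∧
        (∀ f g : Fin Nf, f ≠ g → T.IsNontrivial (QCDField.pseudoRe f g)) ∧
          ∃ Δ > 0, T.HasMassGap Δ ∧
            (((QCDRegularisation.mk reg.a reg.a_pos reg.tendsto_a reg.β reg.L reg.tendsto_L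
        (fun k => reg.mcrit k + reg.a k * J / reg.Zm k) reg.Zm reg.Zm_pos : QCDRegularisation Nf).restrict ψ
          hψ.tendsto_atTop).scheme m z shift).HasLatticeMassGap Δ := by
  sorry

/-- **Stub J — the jump line is chiral** (verbatim rev 1–3; the planner's child `JumpLineIsChiral`, in `∀ reg'` form).  A
regularisation with `HasMassScaling`, two-loop `HasAsymptoticScaling`, `m_crit'(k) → 0`, the two-sided parity pin at ZERO
threshold and the `QCDOf` body at every positive tuple is CHIRAL AT ZERO: for every `ε > 0` some positive tuple has no
uniform lattice gap `ε`.  Physics: the parity-jump line is the zero-mode edge of `H_W = γ₅ D_W` on physical volumes, i.e. the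
chiral point, and massless `N_f ≥ 2` QCD is gapless (Goldstone/GMOR).  OPEN, crux-sized (equivalently
`¬ UniformlyGappedZeroPinnedQCD N_f`, Negative `stubJumpLineIsChiral_iff_not_exists`). -/
theorem stub_jumpLineIsChiral : ∀ Nf : ℕ, (Nf = 2 ∨ Nf = 3) → ∀ reg' : QCDRegularisation Nf,
    reg'.HasMassScaling → (reg'.scheme 0 0 0).HasAsymptoticScaling → Tendsto reg'.mcrit atTop (𝓝 0) →
    (∀ m : Fin Nf → ℝ, (∀ f, 0 < m f) → ∃ R : ℝ, 0 < R ∧ PinClause Nf reg' 0 m R ∧ UpperPin Nf reg' 0 m R) →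
    (∀ m : Fin Nf → ℝ, (∀ f, 0 < m f) → ∃ (z shift : QCDField Nf → ℕ → ℝ) (T : OSData (QCDField Nf) 4),
      IsQCDAlong (reg'.scheme m z shift) T ∧ T.IsNontrivial QCDField.glue ∧ T.IsNonGaussian QCDField.glue ∧
        (∀ f g : Fin Nf, f ≠ g → T.IsNontrivial (QCDField.pseudoRe f g)) ∧
          ∃ Δ > 0, T.HasMassGap Δ ∧ (reg'.scheme m z shift).HasLatticeMassGap Δ) →
    reg'.IsChiralAtZero := by
  sorry

/-! ## §2 Composition A -/

/-- **The crux along line `Sketch`, composition A, modulo `stub_bandPinsAlong | stub_frame | stub_lightBodySubseq |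
stub_jumpLineIsChiral`** (pure bookkeeping over landed glue; its conclusion is the route decl BY NAME).  Given `N_f ∈ {2,3}`
and a threshold regularisation `reg` with its package: (B2a) `stub_bandPinsAlong` through the landed
`stub_jumpGerm_of_bandPinsAlong` picks `φ` and the germ `J` with the zero-threshold pin after re-centring; the package passes to
`reg₁ := reg.restrict φ` (landed heredity); (B2b′) the frame (α) through the landed `physicalBranch_of_frame` gives
`m_crit ∘ φ → 0`, hence `m_crit' → 0` for `u :=` `reg₁` re-centred at `J` (`tendsto_mcrit_recentre`); (B2c′) gives `ψ` and the
body of `u.restrict ψ` at every positive tuple; scalings, `m_crit' → 0` and the zero-threshold pin ride along `ψ`; (J) on the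
witness `u.restrict ψ` gives `IsChiralAtZero`. -/
theorem LightQuarkCompletion_of : Summit.QuantumFields.QCD.Theses.NestedDissectionSea.LightQuarkCompletion := by
  intro Nf hNf reg hMS hAS hbr M₀ hM₀ hpin hbody
  have hNf16 : Nf ≤ 16 := by rcases hNf with rfl | rfl <;> norm_num
  -- (B2a) the subsequence and the germ, from band pins along a subsequence
  obtain ⟨φ, hφ, J, hpin'⟩ :=
    stub_jumpGerm_of_bandPinsAlong stub_bandPinsAlong Nf hNf reg hMS hAS hbr M₀ hM₀ hpin hbody
  -- the package passes to the subsequence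
  set reg₁ : QCDRegularisation Nf := reg.restrict φ hφ.tendsto_atTop with hreg₁
  have hMS₁ : reg₁.HasMassScaling := StronglyChiralSubsequence.hasMassScaling_restrict reg φ hφ hMS
  have hAS₁ : (reg₁.scheme 0 0 0).HasAsymptoticScaling :=
    StronglyChiralSubsequence.hasAsymptoticScaling_restrict reg φ hφ hAS
  have hbr₁ : ∀ᶠ k : ℕ in atTop, -1 ≤ reg₁.mcrit k := branch_restrict reg φ hφ hbr
  have hpin₁ := pin_restrict reg φ hφ hpin
  have hbody₁ := body_restrict reg φ hφ hbody
  -- (B2b′) the physical branch along the subsequence, from the frame (α)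
  have hlim₁ : Tendsto reg₁.mcrit atTop (𝓝 0) :=
    physicalBranch_of_frame stub_frame Nf hNf reg₁ hMS₁ hAS₁ M₀ hM₀ hpin₁
  -- (B2c′) the light body of the re-centred regularisation along a further subsequence `ψ`
  obtain ⟨ψ, hψ, hbody'⟩ := stub_lightBodySubseq Nf hNf reg₁ hMS₁ hAS₁ hbr₁ M₀ hM₀ hpin₁ hbody₁ J hpin'
  -- the re-centred regularisation `u` and its package at zero threshold
  set u : QCDRegularisation Nf := (QCDRegularisation.mk reg₁.a reg₁.a_pos reg₁.tendsto_a reg₁.β reg₁.L reg₁.tendsto_L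
      (fun k => reg₁.mcrit k + reg₁.a k * J / reg₁.Zm k) reg₁.Zm reg₁.Zm_pos : QCDRegularisation Nf) with hu
  have hMSu : u.HasMassScaling := hasMassScaling_recentre reg₁ J hMS₁
  have hASu : (u.scheme 0 0 0).HasAsymptoticScaling := hasAsymptoticScaling_recentre reg₁ J hAS₁
  have hlimu : Tendsto u.mcrit atTop (𝓝 0) := tendsto_mcrit_recentre reg₁ J hNf16 hMS₁ hlim₁
  have hpinu : ∀ m : Fin Nf → ℝ, (∀ f, 0 < m f) → ∃ R : ℝ, 0 < R ∧ PinClause Nf u 0 m R ∧ UpperPin Nf u 0 m R := hpin'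
  -- the witness: `u` reindexed along `ψ`
  have hMSw : (u.restrict ψ hψ.tendsto_atTop).HasMassScaling :=
    StronglyChiralSubsequence.hasMassScaling_restrict u ψ hψ hMSu
  have hASw : ((u.restrict ψ hψ.tendsto_atTop).scheme 0 0 0).HasAsymptoticScaling :=
    StronglyChiralSubsequence.hasAsymptoticScaling_restrict u ψ hψ hASu
  have hlimw : Tendsto (u.restrict ψ hψ.tendsto_atTop).mcrit atTop (𝓝 0) := hlimu.comp hψ.tendsto_atTop
  have hpinw := pin_restrict u ψ hψ hpinu
  refine ⟨u.restrict ψ hψ.tendsto_atTop, hMSw, hASw, hlimw, hpinw, ?_, hbody'⟩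
  -- (J) chirality of the witness
  exact stub_jumpLineIsChiral Nf hNf _ hMSw hASw hlimw hpinw hbody'

/-! ## §3 Composition B — through the sibling's `ChiralCompletion` (item stmt-QuantumFields-17661) -/

/-- **Stub — `HeavyThresholdYMBridge.ChiralCompletion` (item stmt-QuantumFields-17661), VERBATIM** (its Theses decl is not yet
served by the farm's olean; swap this text for the name `Summit.QuantumFields.QCD.Theses.HeavyThresholdYMBridge.ChiralCompletion`
when it is).  For `N_f ∈ {2,3}`, every regularisation with `HasMassScaling` carrying the `QCDOf` body at every tuple above SOME
threshold `M₀` carries it, after ONE constant RGI re-pin `δ` of its critical mass (`reg.scheme (fun f => m f + δ)`), at EVERY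
positive tuple, and is chiral at zero there.  DELEGATED to item 17661 (OPEN there; route HeavyThresholdYMBridge) — OR to items
18327 ∧ 18328 (`QuarksAsStableAction.MassContinuation`, `ChiralTupleGapless`) through the LANDED pure-logic reduction
`stub_chiralCompletion17661_of_massContinuation` (p142846, least admissible threshold). -/
theorem stub_chiralCompletion17661 : ∀ Nf : ℕ, Nf = 2 ∨ Nf = 3 → ∀ (reg : QCDRegularisation Nf) (M₀ : ℝ),
    reg.HasMassScaling →
    (∀ m : Fin Nf → ℝ, (∀ f, M₀ < m f) → ∃ (z shift : QCDField Nf → ℕ → ℝ) (T : OSData (QCDField Nf) 4),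
      IsQCDAlong (reg.scheme m z shift) T ∧ T.IsNontrivial QCDField.glue ∧ T.IsNonGaussian QCDField.glue ∧
        (∀ f g : Fin Nf, f ≠ g → T.IsNontrivial (QCDField.pseudoRe f g)) ∧
          ∃ Δ > 0, T.HasMassGap Δ ∧ (reg.scheme m z shift).HasLatticeMassGap Δ) →
    ∃ δ : ℝ, (∀ ε > (0 : ℝ), ∃ m : Fin Nf → ℝ, (∀ f, 0 < m f) ∧
        ¬ (reg.scheme (fun f => m f + δ) 0 0).HasLatticeMassGap ε) ∧
      ∀ m : Fin Nf → ℝ, (∀ f, 0 < m f) → ∃ (z shift : QCDField Nf → ℕ → ℝ) (T : OSData (QCDField Nf) 4),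
        IsQCDAlong (reg.scheme (fun f => m f + δ) z shift) T ∧ T.IsNontrivial QCDField.glue ∧
          T.IsNonGaussian QCDField.glue ∧ (∀ f g : Fin Nf, f ≠ g → T.IsNontrivial (QCDField.pseudoRe f g)) ∧
            ∃ Δ > 0, T.HasMassGap Δ ∧ (reg.scheme (fun f => m f + δ) z shift).HasLatticeMassGap Δ := by
  sorry

/-- **Stub — some corner of a threshold-pinned regularisation is pinned** (rev 6, LOCATED form of the rev-4/5 stub
`stub_chiralCornerPinned`; the ONE supplier-less fact of composition B).  For `N_f ∈ {2,3}` and every regularisation `reg`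
carrying the crux's threshold package at `M₀` (`HypAt`: both scalings, weak branch, `0 ≤ M₀`, two-sided pin and body above
`M₀`): if SOME RGI offset `δ` is a corner of the up-shift family — `upShift reg δ` (`m_crit ↦ m_crit + a δ / Z_m`) is CHIRAL AT
ZERO and carries the BODY AT EVERY POSITIVE TUPLE — then some corner `δ` also carries the TWO-SIDED PARITY PIN AT ZERO
THRESHOLD: for every positive sea tuple some radius `R > 0` with, for every `M > 0`, eventually in `k`,
`P(Re det D_W(m_crit + a(δ − M)/Z_m) < 0) ≥ 1/4` on odd tori of side `≥ R` and `P(Re det D_W(m_crit + a(δ + M)/Z_m) < 0) ≤ 1/8`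
on odd tori of side in `[R, 2R]` (phase-quenched weight).  Physics: the chiral corner — where the lattice gap closes and below
which no body exists — IS the parity-jump line of the Wilson determinant on physical volumes (index modes have crossed a
distance `M` below it: EarlyCrosserLaw (b) at zero threshold; a distance `M` above it negative determinants are rare in fixed
physical volume: (b″) at zero threshold, the constant-free dilution (L5) at every `m > 0`).  The corner set is order-connected
(`ordConnected_cornerSet`) and physically a single offset; the located form asks for the pin only where the composition reads
it.  Implied by the ∀δ-form (`chiralCornerPinnedExists_of_forall`).  OPEN, no supplier in the tree. -/
theorem stub_chiralCornerPinnedExists : ∀ Nf : ℕ, (Nf = 2 ∨ Nf = 3) → ∀ (reg : QCDRegularisation Nf) (M₀ : ℝ),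
    HypAt Nf reg M₀ → (∃ δ : ℝ, (upShift reg δ).IsChiralAtZero ∧ Body Nf (upShift reg δ) 0) →
    ∃ δ : ℝ, (upShift reg δ).IsChiralAtZero ∧ Body Nf (upShift reg δ) 0 ∧ PinPkg Nf (upShift reg δ) 0 := by
  sorry

/-- **The crux along line `Sketch`, composition B (located form), modulo `stub_frame | stub_chiralCompletion17661 |
stub_chiralCornerPinnedExists`** (pure bookkeeping, conclusion = the route decl BY NAME, no subsequence; its landable form is
the registered helper `lightQuarkCompletion_of_chiralCornerPinnedExists`).  Given the threshold package at `(reg, M₀)`: the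
17661 text gives a corner `δ₁` (`isChiralAtZero_upShift_of_addConst`, `body_upShift_zero_of_addConst`); the stub gives a corner
`δ` carrying the two-sided pin at zero threshold as well; both scalings survive the up-shift (`Anatomy`); (α) through
`physicalBranch_of_frame` gives `m_crit → 0` for `reg`, hence for `upShift reg δ` (`tendsto_mcrit_upShift`).  Witness:
`reg' := upShift reg δ`. -/
theorem LightQuarkCompletion_of_chiralCompletion :
    Summit.QuantumFields.QCD.Theses.NestedDissectionSea.LightQuarkCompletion := by
  rw [lightQuarkCompletion_iff]
  intro Nf hNf reg M₀ hH
  obtain ⟨hMS, hAS, hbr, hM₀, hpin, hbody⟩ := hH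
  have hNf16 : Nf ≤ 16 := by rcases hNf with rfl | rfl <;> norm_num
  -- item 17661 (verbatim stub) inhabits the corner set of `reg`
  obtain ⟨δ₁, hχ₁, hbody₁⟩ := stub_chiralCompletion17661 Nf hNf reg M₀ hMS hbody
  have hcorner : ∃ δ : ℝ, (upShift reg δ).IsChiralAtZero ∧ Body Nf (upShift reg δ) 0 :=
    ⟨δ₁, isChiralAtZero_upShift_of_addConst reg δ₁ hχ₁, body_upShift_zero_of_addConst reg δ₁ hbody₁⟩
  -- the stub pins ONE corner
  obtain ⟨δ, hχ', hbody', hpin'⟩ :=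
    stub_chiralCornerPinnedExists Nf hNf reg M₀ ⟨hMS, hAS, hbr, hM₀, hpin, hbody⟩ hcorner
  -- the physical branch from the frame (α), transported through the up-shift
  have hlim : Tendsto reg.mcrit atTop (𝓝 0) := physicalBranch_of_frame stub_frame Nf hNf reg hMS hAS M₀ hM₀ hpin
  exact ⟨upShift reg δ, (hasMassScaling_upShift reg δ).2 hMS, (hasAsymptoticScaling_upShift reg δ).2 hAS,
    tendsto_mcrit_upShift reg δ hNf16 hMS hlim, hpin', hχ', hbody'⟩

/-- **Composition B with the 17661 text supplied by the two `QuarksAsStableAction` items BY NAME** (landed reduction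
`stub_chiralCompletion17661_of_massContinuation`, p142846: `MassContinuation` (stmt-18327) → `ChiralTupleGapless` (stmt-18328) →
17661 text, by the least admissible threshold).  So the crux closes from items 17012 ((α), `stub_frame`), 18327, 18328 and the
ONE supplier-less fact `stub_chiralCornerPinnedExists`. -/
theorem LightQuarkCompletion_of_stableActionItems
    (h18327 : Summit.QuantumFields.QCD.Theses.QuarksAsStableAction.MassContinuation)
    (h18328 : Summit.QuantumFields.QCD.Theses.QuarksAsStableAction.ChiralTupleGapless) :
    Summit.QuantumFields.QCD.Theses.NestedDissectionSea.LightQuarkCompletion := by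
  rw [lightQuarkCompletion_iff]
  intro Nf hNf reg M₀ hH
  obtain ⟨hMS, hAS, hbr, hM₀, hpin, hbody⟩ := hH
  have hNf16 : Nf ≤ 16 := by rcases hNf with rfl | rfl <;> norm_num
  obtain ⟨δ₁, hχ₁, hbody₁⟩ := stub_chiralCompletion17661_of_massContinuation h18327 h18328 Nf hNf reg M₀ hMS hbody
  obtain ⟨δ, hχ', hbody', hpin'⟩ := stub_chiralCornerPinnedExists Nf hNf reg M₀ ⟨hMS, hAS, hbr, hM₀, hpin, hbody⟩
    ⟨δ₁, isChiralAtZero_upShift_of_addConst reg δ₁ hχ₁, body_upShift_zero_of_addConst reg δ₁ hbody₁⟩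
  have hlim : Tendsto reg.mcrit atTop (𝓝 0) := physicalBranch_of_frame stub_frame Nf hNf reg hMS hAS M₀ hM₀ hpin
  exact ⟨upShift reg δ, (hasMassScaling_upShift reg δ).2 hMS, (hasAsymptoticScaling_upShift reg δ).2 hAS,
    tendsto_mcrit_upShift reg δ hNf16 hMS hlim, hpin', hχ', hbody'⟩

end Summit.QuantumFields.QCD.Theorems.LightQuarkJumpLine

end
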